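import Mathlib.Analysis.Calculus.Deriv.Inv
import Mathlib.Analysis.Calculus.FDeriv.Mul
import Mathlib.Analysis.Calculus.FDeriv.Prod
import Mathlib.Analysis.SpecialFunctions.Sqrt
import Mathlib.LinearAlgebra.Matrix.ToLin
import Mathlib.LinearAlgebra.Determinant
import Mathlib.Topology.Algebra.Module.FiniteDimension
import Literature.NumberTheory.Transcendental.KZMellinFibres

/-!
# `MultiplicationAccessible` (stmt-KontsevichZagierPeriods-12305), line
`shifted-family-prime-sieve`, stub `stub_dupPhi`

The `p = 2` rung of the shifted Gauss-multiplication family is Legendre duplication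
`B(x,s) B(x+½,s) = 4^s B(2x,2s) B(s,s)`. The neighbour stub `stub_dupSymmetrise` produces the
symmetrised Kummer pull-back `q = [(0,1)², 2(η₀η₁)^{2x−1}(η₀+η₁)((1−η₀²)(1−η₁²))^{s−1}]`; THIS
stub is ONE change-of-variables move (Kontsevich–Zagier rule (2), `KZ.changeOfVariablesRel`)
from `q` to the box representation `r' = [(0,1)², 4^s ξ₀^{2x−1}(1−ξ₀)^{2s−1}(ξ₁(1−ξ₁))^{s−1}]`
of `4^s B(2x,2s) B(s,s)`, along the rational bijection OF THE OPEN BOX ONTO ITSELF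
`Φ(η₀, η₁) = (η₀η₁, (1 − η₀)(1 + η₁)/(2(1 − η₀η₁)))`.

* Side conditions of the move (adapted from the refuter's kernel-checked evidence
  `Cruxes/MultiplicationAccessible/DrefutePhiFacts.lean`): `Φ` maps the open box into itself
  (`dupPhi_mapsTo`), injectively (`dupPhi_injOn`) and onto (`dupPhi_surjOn`: inverse through
  `d = (2ξ₁ − 1)(1 − ξ₀)`, `η₀ = (−d + √(d² + 4ξ₀))/2`, `η₁ = η₀ + d`), so
  `Φ '' (0,1)² = (0,1)²`; `Φ` is a `ℚ`-semialgebraic map (one polynomial and one rational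
  coordinate); `Φ` has derivative the Jacobian matrix
  `[[η₁, η₀], [−(1 − η₁²)/(2(1 − η₀η₁)²), (1 − η₀²)/(2(1 − η₀η₁)²)]]` wherever `η₀η₁ ≠ 1`
  (`hasFDerivAt_dupPhi`), of determinant `(η₀ + η₁)/(2(1 − η₀η₁)) > 0` (`det_dupPhiDeriv`).
* The pull-back identity `q.integrand η = r'.integrand (Φ η)·|det Φ'(η)|` (`dup_pullback`), from
  the level identity `4(1−ξ₀)²ξ₁(1−ξ₁) ∘ Φ = (1−η₀²)(1−η₁²)`, `1 − ξ₀ = 1 − η₀η₁` and the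
  bookkeeping `4^s(1−ξ₀)^{2s−1}(ξ₁(1−ξ₁))^{s−1} = 4·[4(1−ξ₀)²ξ₁(1−ξ₁)]^{s−1}·(1−ξ₀)`.

To keep this a pure proof file (no definitions, no notation) the chart lemmas are stated for an
arbitrary `Φ` under the defining hypothesis `hΦ : ∀ η, Φ η = ![…]` and an arbitrary `Φ'` under
the two coordinate formulas of the Jacobian (`hΦ'0`, `hΦ'1`); `stub_dupPhi` instantiates them.

References: M. Kontsevich, D. Zagier, *Periods* (2001), §1.2 rule (2); Andrews–Askey–Roy 1999,
Thm 1.5.1 (Legendre duplication).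
-/

noncomputable section

open MeasureTheory Set
open Literature.NumberTheory.Transcendental
open Literature.NumberTheory.Transcendental.KZ
open Literature.ModelTheory.ExponentialFields (IsSemialgebraic)
open MvPolynomial (aeval X C)

namespace Summit.KontsevichZagierPeriods.TerasomaMultiplication.MultiplicationAccessible

namespace DupPhi

-- adapted from Cruxes/MultiplicationAccessible/DrefutePhiFacts.lean (refuter drefute, 2026-08-16)

/-- Membership in the open box `(0,1)²`, coordinatewise. [folklore] -/
theorem mem_box {z : Fin 2 → ℝ} :
    z ∈ {z : Fin 2 → ℝ | ∀ i, z i ∈ Set.Ioo (0:ℝ) 1} ↔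
      (0 < z 0 ∧ z 0 < 1) ∧ (0 < z 1 ∧ z 1 < 1) := by
  simp [Fin.forall_fin_two]

section Chart

variable {Φ : (Fin 2 → ℝ) → (Fin 2 → ℝ)}
  (hΦ : ∀ η, Φ η = ![η 0 * η 1, (1 - η 0) * (1 + η 1) / (2 * (1 - η 0 * η 1))])

include hΦ

/-- The two coordinates of the chart. [folklore] -/
theorem dupPhi_apply (η : Fin 2 → ℝ) :
    Φ η 0 = η 0 * η 1 ∧ Φ η 1 = (1 - η 0) * (1 + η 1) / (2 * (1 - η 0 * η 1)) := by
  simp [hΦ]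

/-- `Φ` maps the open box into the open box. [folklore] -/
theorem dupPhi_mapsTo :
    MapsTo Φ {z : Fin 2 → ℝ | ∀ i, z i ∈ Set.Ioo (0:ℝ) 1}
      {z : Fin 2 → ℝ | ∀ i, z i ∈ Set.Ioo (0:ℝ) 1} := by
  intro η hη
  rw [mem_box] at hη ⊢
  obtain ⟨⟨h0, h0'⟩, ⟨h1, h1'⟩⟩ := hη
  have hP : η 0 * η 1 < 1 := by nlinarith
  have hD : 0 < 2 * (1 - η 0 * η 1) := by nlinarith
  rw [(dupPhi_apply hΦ η).1, (dupPhi_apply hΦ η).2, div_lt_one hD]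
  exact ⟨⟨by positivity, hP⟩, div_pos (by nlinarith) hD, by nlinarith⟩

/-- `Φ` is injective on the open box: the product and the second coordinate determine the
difference, and a positive pair is determined by its product and difference. [folklore] -/
theorem dupPhi_injOn : InjOn Φ {z : Fin 2 → ℝ | ∀ i, z i ∈ Set.Ioo (0:ℝ) 1} := by
  intro η hη η' hη' heq
  rw [mem_box] at hη hη'
  obtain ⟨⟨h0, h0'⟩, ⟨h1, h1'⟩⟩ := hη
  obtain ⟨⟨g0, g0'⟩, ⟨g1, g1'⟩⟩ := hη'
  have hP' : η' 0 * η' 1 < 1 := by nlinarith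
  have e0 : η 0 * η 1 = η' 0 * η' 1 := by
    rw [← (dupPhi_apply hΦ η).1, ← (dupPhi_apply hΦ η').1, heq]
  have e1 : (1 - η 0) * (1 + η 1) = (1 - η' 0) * (1 + η' 1) := by
    have h := congr_fun heq 1
    rw [(dupPhi_apply hΦ η).2, (dupPhi_apply hΦ η').2, e0] at h
    have hD : (2 * (1 - η' 0 * η' 1)) ≠ 0 := by nlinarith
    rw [div_eq_div_iff hD hD] at h
    exact mul_right_cancel₀ hD h
  have key : (η 0 - η' 0) * (η 0 + η' 1) = 0 := by nlinarith
  have h00 : η 0 = η' 0 := by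
    rcases mul_eq_zero.mp key with h | h
    · linarith
    · nlinarith
  have h11 : η 1 = η' 1 := by nlinarith
  funext i
  fin_cases i
  · exact h00
  · exact h11

/-- `Φ` maps the open box ONTO the open box: with `d = (2ξ₁ − 1)(1 − ξ₀)` and
`R = √(d² + 4ξ₀)` the preimage of `ξ` is `((−d + R)/2, (d + R)/2)`. [folklore] -/
theorem dupPhi_surjOn :
    SurjOn Φ {z : Fin 2 → ℝ | ∀ i, z i ∈ Set.Ioo (0:ℝ) 1}
      {z : Fin 2 → ℝ | ∀ i, z i ∈ Set.Ioo (0:ℝ) 1} := by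
  intro ξ hξ
  rw [mem_box] at hξ
  obtain ⟨⟨k0, k0'⟩, ⟨k1, k1'⟩⟩ := hξ
  set d : ℝ := (2 * ξ 1 - 1) * (1 - ξ 0) with hd
  set R : ℝ := Real.sqrt (d ^ 2 + 4 * ξ 0) with hR
  have hR2 : R ^ 2 = d ^ 2 + 4 * ξ 0 := Real.sq_sqrt (by positivity)
  have hR0 : 0 ≤ R := Real.sqrt_nonneg _
  have hd1 : d < 1 - ξ 0 := by rw [hd]; nlinarith
  have hd2 : -d < 1 - ξ 0 := by rw [hd]; nlinarith
  have hRd : |d| < R := by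
    rw [hR, Real.lt_sqrt (abs_nonneg d), sq_abs]
    linarith
  have hRd1 : d < R := lt_of_le_of_lt (le_abs_self d) hRd
  have hRd2 : -d < R := lt_of_le_of_lt (neg_le_abs d) hRd
  have hRu1 : R < 2 + d := by
    rw [hR, Real.sqrt_lt' (by linarith)]
    nlinarith
  have hRu2 : R < 2 - d := by
    rw [hR, Real.sqrt_lt' (by linarith)]
    nlinarith
  refine ⟨![(-d + R) / 2, (d + R) / 2], ?_, ?_⟩
  · rw [mem_box]
    simp only [Matrix.cons_val_zero, Matrix.cons_val_one, Matrix.cons_val_fin_one]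
    exact ⟨⟨by linarith, by linarith⟩, by linarith, by linarith⟩
  · have hprod : (-d + R) / 2 * ((d + R) / 2) = ξ 0 := by nlinarith
    rw [hΦ]
    funext i
    fin_cases i
    · simp [hprod]
    · simp only [Fin.mk_one, Matrix.cons_val_one, Matrix.cons_val_zero, Matrix.cons_val_fin_one]
      rw [hprod, div_eq_iff (by nlinarith)]
      nlinarith

/-- The image of the open box under `Φ` is the open box (the `r'.domain = Φ '' r.domain` side
condition of the move). [folklore] -/
theorem dupPhi_image_box :
    Φ '' {z : Fin 2 → ℝ | ∀ i, z i ∈ Set.Ioo (0:ℝ) 1} =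
      {z : Fin 2 → ℝ | ∀ i, z i ∈ Set.Ioo (0:ℝ) 1} :=
  (dupPhi_surjOn hΦ).image_eq_of_mapsTo (dupPhi_mapsTo hΦ)

/-- `Φ` is a `ℚ`-semialgebraic map on the open box: its first coordinate is the polynomial
`X₀X₁`, its second the quotient `(1 − X₀)(1 + X₁) / (2(1 − X₀X₁))` with non-vanishing
denominator. [cite: KontsevichZagier2001, §1.2] -/
theorem isSemialgebraicMapOn_dupPhi :
    IsSemialgebraicMapOn ℚ {z : Fin 2 → ℝ | ∀ i, z i ∈ Set.Ioo (0:ℝ) 1} Φ := by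
  have hσ : IsSemialgebraic ℚ {z : Fin 2 → ℝ | ∀ i, z i ∈ Set.Ioo (0:ℝ) 1} :=
    KZ.isSemialgebraic_box 2
  refine IsSemialgebraicMapOn.of_forall hσ fun j => ?_
  fin_cases j
  · refine (isSemialgebraicFunOn_aeval hσ (X 0 * X 1 : MvPolynomial (Fin 2) ℚ)).congr ?_
    intro η _
    simp [hΦ]
  · have hq : ∀ η ∈ {z : Fin 2 → ℝ | ∀ i, z i ∈ Set.Ioo (0:ℝ) 1},
        aeval η (C 2 * (1 - X 0 * X 1) : MvPolynomial (Fin 2) ℚ) ≠ 0 := by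
      intro η hη
      obtain ⟨⟨h0, h0'⟩, ⟨h1, h1'⟩⟩ := mem_box.mp hη
      have hP : η 0 * η 1 < 1 := by nlinarith
      simp only [map_mul, MvPolynomial.aeval_C, map_sub, map_one, MvPolynomial.aeval_X,
        eq_ratCast]
      push_cast
      exact mul_ne_zero two_ne_zero (sub_pos.mpr hP).ne'
    refine (isSemialgebraicFunOn_aeval_div_aeval hσ
      ((1 - X 0) * (1 + X 1) : MvPolynomial (Fin 2) ℚ) (C 2 * (1 - X 0 * X 1)) hq).congr ?_
    intro η _
    simp only [map_mul, map_sub, map_add, map_one, MvPolynomial.aeval_X, MvPolynomial.aeval_C,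
      eq_ratCast, Fin.mk_one, hΦ, Matrix.cons_val_one, Matrix.cons_val_fin_one]
    push_cast
    ring

variable {Φ' : (Fin 2 → ℝ) → (Fin 2 → ℝ) →L[ℝ] (Fin 2 → ℝ)}
  (hΦ'0 : ∀ η v, Φ' η v 0 = η 1 * v 0 + η 0 * v 1)
  (hΦ'1 : ∀ η v, Φ' η v 1 = -(1 - η 1 ^ 2) / (2 * (1 - η 0 * η 1) ^ 2) * v 0 +
    (1 - η 0 ^ 2) / (2 * (1 - η 0 * η 1) ^ 2) * v 1)

include hΦ'0 hΦ'1

omit hΦ in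
/-- `det Φ'(η) = (η₀ + η₁) / (2(1 − η₀η₁))`: `Φ' η` is the linear map of the Jacobian matrix
`[[η₁, η₀], [−(1 − η₁²)/(2(1 − η₀η₁)²), (1 − η₀²)/(2(1 − η₀η₁)²)]]`. [folklore] -/
theorem det_dupPhiDeriv (η : Fin 2 → ℝ) (h : η 0 * η 1 ≠ 1) :
    (Φ' η).det = (η 0 + η 1) / (2 * (1 - η 0 * η 1)) := by
  have h' : (1 - η 0 * η 1) ≠ 0 := sub_ne_zero.mpr (Ne.symm h)
  have hlin : ((Φ' η : (Fin 2 → ℝ) →L[ℝ] (Fin 2 → ℝ)) : (Fin 2 → ℝ) →ₗ[ℝ] (Fin 2 → ℝ)) =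
      Matrix.toLin' (!![η 1, η 0;
        -(1 - η 1 ^ 2) / (2 * (1 - η 0 * η 1) ^ 2), (1 - η 0 ^ 2) / (2 * (1 - η 0 * η 1) ^ 2)] :
        Matrix (Fin 2) (Fin 2) ℝ) := by
    refine LinearMap.ext fun v => funext fun i => ?_
    fin_cases i
    · simp [hΦ'0, Matrix.mulVec, dotProduct, Fin.sum_univ_two]
    · simp [hΦ'1, Matrix.mulVec, dotProduct, Fin.sum_univ_two]
  change LinearMap.det ((Φ' η : (Fin 2 → ℝ) →L[ℝ] (Fin 2 → ℝ)) :
    (Fin 2 → ℝ) →ₗ[ℝ] (Fin 2 → ℝ)) = _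
  rw [hlin, LinearMap.det_toLin', Matrix.det_fin_two_of]
  have key : η 1 * ((1 - η 0 ^ 2) / (2 * (1 - η 0 * η 1) ^ 2)) -
      η 0 * (-(1 - η 1 ^ 2) / (2 * (1 - η 0 * η 1) ^ 2)) =
      ((η 0 + η 1) * (1 - η 0 * η 1)) / (2 * (1 - η 0 * η 1) ^ 2) := by
    ring
  rw [key, div_eq_div_iff (by positivity) (by positivity)]
  ring

/-- `Φ` has derivative `Φ' η` at every `η` with `η₀η₁ ≠ 1` (in particular on the open box):
row by row (`hasFDerivAt_pi''`), product and quotient rules for the coordinate functions.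
[folklore] -/
theorem hasFDerivAt_dupPhi (η : Fin 2 → ℝ) (h : η 0 * η 1 ≠ 1) :
    HasFDerivAt Φ (Φ' η) η := by
  have h' : (1 - η 0 * η 1) ≠ 0 := sub_ne_zero.mpr (Ne.symm h)
  have hD : (2 * (1 - η 0 * η 1)) ≠ 0 := mul_ne_zero two_ne_zero h'
  -- coordinate projections and the derivatives of the building blocks
  set π0 : (Fin 2 → ℝ) →L[ℝ] ℝ := ContinuousLinearMap.proj (R := ℝ) (φ := fun _ : Fin 2 => ℝ) 0
    with hπ0
  set π1 : (Fin 2 → ℝ) →L[ℝ] ℝ := ContinuousLinearMap.proj (R := ℝ) (φ := fun _ : Fin 2 => ℝ) 1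
    with hπ1
  have hc0 : HasFDerivAt (fun y : Fin 2 → ℝ => y 0) π0 η := hasFDerivAt_apply (𝕜 := ℝ) 0 η
  have hc1 : HasFDerivAt (fun y : Fin 2 → ℝ => y 1) π1 η := hasFDerivAt_apply (𝕜 := ℝ) 1 η
  have hprod : HasFDerivAt (fun y : Fin 2 → ℝ => y 0 * y 1) (η 0 • π1 + η 1 • π0) η :=
    hc0.mul hc1
  have hrow1 : HasFDerivAt
      (fun y : Fin 2 → ℝ => (1 - y 0) * (1 + y 1) * (2 * (1 - y 0 * y 1))⁻¹)
      (((1 - η 0) * (1 + η 1)) • ((-((2 * (1 - η 0 * η 1)) ^ 2)⁻¹) •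
          ((2:ℝ) • -(η 0 • π1 + η 1 • π0))) +
        (2 * (1 - η 0 * η 1))⁻¹ • ((1 - η 0) • π1 + (1 + η 1) • (-π0))) η :=
    ((hc0.const_sub 1).mul (hc1.const_add 1)).mul
      ((hasDerivAt_inv hD).comp_hasFDerivAt η ((hprod.const_sub 1).const_mul (2:ℝ)))
  refine hasFDerivAt_pi'' fun i => ?_
  fin_cases i
  · -- row 0
    have hL : (ContinuousLinearMap.proj 0).comp (Φ' η) = η 0 • π1 + η 1 • π0 := by
      refine ContinuousLinearMap.ext fun v => ?_
      change Φ' η v 0 = _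
      rw [hΦ'0]
      simp only [hπ0, hπ1, _root_.add_apply, FunLike.coe_smul, Pi.smul_apply, smul_eq_mul,
        ContinuousLinearMap.proj_apply]
      ring
    have key : HasFDerivAt (fun y : Fin 2 → ℝ => y 0 * y 1)
        ((ContinuousLinearMap.proj 0).comp (Φ' η)) η := by
      rw [hL]
      exact hprod
    refine key.congr_of_eventuallyEq (Filter.Eventually.of_forall fun y => ?_)
    simp [hΦ]
  · -- row 1
    have hL : (ContinuousLinearMap.proj 1).comp (Φ' η) =
        ((1 - η 0) * (1 + η 1)) • ((-((2 * (1 - η 0 * η 1)) ^ 2)⁻¹) •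
            ((2:ℝ) • -(η 0 • π1 + η 1 • π0))) +
          (2 * (1 - η 0 * η 1))⁻¹ • ((1 - η 0) • π1 + (1 + η 1) • (-π0)) := by
      refine ContinuousLinearMap.ext fun v => ?_
      change Φ' η v 1 = _
      rw [hΦ'1]
      simp only [hπ0, hπ1, _root_.add_apply, FunLike.coe_smul, Pi.smul_apply, smul_eq_mul,
        ContinuousLinearMap.proj_apply, _root_.neg_apply]
      field_simp
      ring
    have key : HasFDerivAt
        (fun y : Fin 2 → ℝ => (1 - y 0) * (1 + y 1) * (2 * (1 - y 0 * y 1))⁻¹)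
        ((ContinuousLinearMap.proj 1).comp (Φ' η)) η := by
      rw [hL]
      exact hrow1
    refine key.congr_of_eventuallyEq (Filter.Eventually.of_forall fun y => ?_)
    simp [hΦ, div_eq_mul_inv]

end Chart

/-- **The pull-back identity** of the duplication chart on the open box (Jacobian
`(a + b)/(2(1 − ab))` included): for `0 < a, b < 1` and real `x, s`,
`2(ab)^{2x−1}(a+b)((1−a²)(1−b²))^{s−1}
  = 4^s (ab)^{2x−1}(1−ab)^{2s−1} ξ₁^{s−1}(1−ξ₁)^{s−1} · |(a+b)/(2(1−ab))|`,
`ξ₁ = (1 − a)(1 + b)/(2(1 − ab))`, via the level identity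
`4(1 − ab)² ξ₁ (1 − ξ₁) = (1 − a²)(1 − b²)`. [folklore] -/
theorem dup_pullback (x s : ℝ) {a b : ℝ} (ha : 0 < a) (ha' : a < 1) (hb : 0 < b) (hb' : b < 1) :
    2 * (a * b) ^ (2 * x - 1) * (a + b) * ((1 - a ^ 2) * (1 - b ^ 2)) ^ (s - 1) =
      4 ^ s * (a * b) ^ (2 * x - 1) * (1 - a * b) ^ (2 * s - 1) *
        (((1 - a) * (1 + b) / (2 * (1 - a * b))) ^ (s - 1) *
          (1 - (1 - a) * (1 + b) / (2 * (1 - a * b))) ^ (s - 1)) *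
        |(a + b) / (2 * (1 - a * b))| := by
  have hP : a * b < 1 := by nlinarith
  have hD : 0 < 1 - a * b := by linarith
  have hD' : (1 - a * b) ≠ 0 := hD.ne'
  -- `1 − ξ₁ = (1 + a)(1 − b)/(2(1 − ab))` and the level identity
  have h1ξ : 1 - (1 - a) * (1 + b) / (2 * (1 - a * b)) = (1 + a) * (1 - b) / (2 * (1 - a * b)) := by
    field_simp
    ring
  have hL : (1 - a ^ 2) * (1 - b ^ 2) = 4 * (1 - a * b) ^ 2 * ((1 - a) * (1 + b) /
      (2 * (1 - a * b)) * (1 - (1 - a) * (1 + b) / (2 * (1 - a * b)))) := by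
    rw [h1ξ]
    field_simp
    ring
  set ξ : ℝ := (1 - a) * (1 + b) / (2 * (1 - a * b)) with hξ
  have hξpos : 0 < ξ := by
    rw [hξ]
    exact div_pos (mul_pos (by linarith) (by linarith)) (by linarith)
  have h1ξpos : 0 < 1 - ξ := by
    rw [h1ξ]
    exact div_pos (mul_pos (by linarith) (by linarith)) (by linarith)
  rw [abs_of_pos (div_pos (by linarith) (by linarith)), ← Real.mul_rpow hξpos.le h1ξpos.le, hL,
    Real.mul_rpow (by positivity) (mul_pos hξpos h1ξpos).le,
    Real.mul_rpow (x := (4:ℝ)) (y := (1 - a * b) ^ 2) (by norm_num) (by positivity)]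
  have h4 : (4:ℝ) ^ s = 4 ^ (s - 1) * 4 := by
    rw [Real.rpow_sub_one (by norm_num)]
    ring
  have hDp : (1 - a * b) ^ (2 * s - 1) = ((1 - a * b) ^ 2) ^ (s - 1) * (1 - a * b) := by
    rw [show (2 * s - 1) = 2 * (s - 1) + 1 by ring, Real.rpow_add hD, Real.rpow_one,
      Real.rpow_mul hD.le, Real.rpow_two]
  rw [h4, hDp]
  field_simp
  ring

end DupPhi

/-- **Registered stub `stub_dupPhi`** (line `shifted-family-prime-sieve` of crux
stmt-KontsevichZagierPeriods-12305). Duplication, second half: ONE change-of-variables move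
(`KZ.changeOfVariablesRel`) along the rational bijection
`Φ(η₀,η₁) = (η₀η₁, (1−η₀)(1+η₁)/(2(1−η₀η₁)))` of the open box onto itself
(`4(1−ξ₀)²ξ₁(1−ξ₁)∘Φ = (1−η₀²)(1−η₁²)`, `det DΦ = (η₀+η₁)/(2(1−η₀η₁))`) takes the symmetrised
representation `q` to the box representation `r'` of `4^s B(2x,2s) B(s,s)`.
[cite: KontsevichZagier2001, §1.2] -/
theorem stub_dupPhi :
    ∀ (x s : ℚ), 0 < x → 0 < s → ∀ (q r' : KZ.IntegralRep 2),
      q.domain = {z | ∀ i, z i ∈ Set.Ioo (0:ℝ) 1} →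
      Set.EqOn q.integrand (fun z => 2 * (z 0 * z 1) ^ (2 * (x:ℝ) - 1) * (z 0 + z 1) *
        ((1 - z 0 ^ 2) * (1 - z 1 ^ 2)) ^ ((s:ℝ) - 1)) q.domain →
      r'.domain = {z | ∀ i, z i ∈ Set.Ioo (0:ℝ) 1} →
      Set.EqOn r'.integrand (fun z => (4:ℝ) ^ (s:ℝ) * (z 0) ^ (2 * (x:ℝ) - 1) *
        (1 - z 0) ^ (2 * (s:ℝ) - 1) * ((z 1) ^ ((s:ℝ) - 1) * (1 - z 1) ^ ((s:ℝ) - 1))) r'.domain →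
      KZ.Equivalent q r' := by
  intro x s _ _ q r' hq hqi hr' hri
  -- the explicit chart and the continuous linear map of its Jacobian matrix
  let Φ : (Fin 2 → ℝ) → (Fin 2 → ℝ) :=
    fun η => ![η 0 * η 1, (1 - η 0) * (1 + η 1) / (2 * (1 - η 0 * η 1))]
  let Φ' : (Fin 2 → ℝ) → (Fin 2 → ℝ) →L[ℝ] (Fin 2 → ℝ) := fun η =>
    LinearMap.toContinuousLinearMap (Matrix.toLin' (!![η 1, η 0;
      -(1 - η 1 ^ 2) / (2 * (1 - η 0 * η 1) ^ 2), (1 - η 0 ^ 2) / (2 * (1 - η 0 * η 1) ^ 2)] :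
      Matrix (Fin 2) (Fin 2) ℝ))
  have hΦ : ∀ η, Φ η = ![η 0 * η 1, (1 - η 0) * (1 + η 1) / (2 * (1 - η 0 * η 1))] :=
    fun η => rfl
  have hΦ'0 : ∀ η v, Φ' η v 0 = η 1 * v 0 + η 0 * v 1 := fun η v => by
    simp [Φ', Matrix.mulVec, dotProduct, Fin.sum_univ_two]
  have hΦ'1 : ∀ η v, Φ' η v 1 = -(1 - η 1 ^ 2) / (2 * (1 - η 0 * η 1) ^ 2) * v 0 +
      (1 - η 0 ^ 2) / (2 * (1 - η 0 * η 1) ^ 2) * v 1 := fun η v => by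
    simp [Φ', Matrix.mulVec, dotProduct, Fin.sum_univ_two]
  have hbox : ∀ η ∈ q.domain, (0 < η 0 ∧ η 0 < 1) ∧ (0 < η 1 ∧ η 1 < 1) := fun η hη =>
    DupPhi.mem_box.mp (hq ▸ hη)
  have hP : ∀ η ∈ q.domain, η 0 * η 1 ≠ 1 := fun η hη => by
    have hη' := hbox η hη
    exact (by nlinarith [hη'.1.1, hη'.1.2, hη'.2.1, hη'.2.2] : η 0 * η 1 < 1).ne
  -- the side conditions of the move on `q.domain = (0,1)²`
  have hsa : IsSemialgebraicMapOn ℚ q.domain Φ := hq ▸ DupPhi.isSemialgebraicMapOn_dupPhi hΦ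
  have hinj : InjOn Φ q.domain := hq ▸ DupPhi.dupPhi_injOn hΦ
  have himage : r'.domain = Φ '' q.domain := by rw [hq, DupPhi.dupPhi_image_box hΦ, hr']
  refine changeOfVariablesRel_subset_relations ⟨2, q, r', Φ, Φ', hsa,
    fun η hη => (DupPhi.hasFDerivAt_dupPhi hΦ hΦ'0 hΦ'1 η (hP η hη)).hasFDerivWithinAt, hinj,
    himage, fun η hη => ?_, rfl⟩
  -- the pull-back identity on `q.domain`, Jacobian included
  have hΦη : Φ η ∈ r'.domain := himage ▸ mem_image_of_mem Φ hη
  have hη' := hbox η hη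
  rw [hqi hη, hri hΦη]
  beta_reduce
  rw [(DupPhi.dupPhi_apply hΦ η).1, (DupPhi.dupPhi_apply hΦ η).2,
    DupPhi.det_dupPhiDeriv hΦ'0 hΦ'1 η (hP η hη)]
  exact DupPhi.dup_pullback (x:ℝ) (s:ℝ) hη'.1.1 hη'.1.2 hη'.2.1 hη'.2.2

end Summit.KontsevichZagierPeriods.TerasomaMultiplication.MultiplicationAccessible
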